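import Summits.NavierStokesRegularity.NavierStokesRegularity.Theorems.SoloRefuteRi2025

/-!
# C08 `Ri2025` — kernel refutation of the window bound and of THE LEVEL-COUNT INEQUALITY (l.817–829)

Companion of `SoloRefuteRi2025` (same witness family `L = 2^{2^q}`, `n = 2^{L−2}`; text of record
arXiv:2508.19590 v1; skeleton `Literature.Claims.NS.Ri2025`, p465548).  At `n = 2^{L−2}` the window level
is `N = ⌈log₂ n⌉ + 2 = L ∈ S(L)`, and every index `2^{L−3} < k ≤ 2^{L−2}` has `j₀(2k) = L`, so

  `windowSum n ≥ 2^{L−3} · b(L) ≥ 2^{q−2} · n`.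

* `not_Step_avgWindow` — the display's end-to-end conclusion "`Σ_{k≤n, j₀(2k)∈S(⌈log₂n⌉+2)} b(j₀(2k)) ≤ …
  ≤ n, ∀ n ≥ n₀`" (l.817–829, print p.13);
* `not_Step_avgLevelCount` (as printed, every `n`; fails already at `q = 2`: `L = 16`, `n = 2^{14}`,
  `windowSum n ≥ 2^{14}` against `|S(16)| · log₂ 16 ≤ 64`) and `not_Step_avgLevelCountEv` (the «eventually»
  twin) — THE LEVEL-COUNT INEQUALITY, l.817–821 (first two lines of the display, print p.13 top): the window
  sum over the INDICES `k ≤ n` is bounded there by (number of window LEVELS `|S(⌈log₂n⌉+2)|`) × (maximal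
  summand `log₂(⌈log₂n⌉+2)`); the right side is `≤ L · log₂ L = 2^{2^q+q}`, the left side `≥ 2^{q+L−4}`, and
  `2^q + 4 < L` for `q ≥ 2`.  This is the FIRST failing step of §3 Step 2; the averaging bound `StepAvg`
  (refuted in the companion file) is its downstream consumer (`windowBound_of_support`, `stepAvg_of_support`
  in the skeleton; Lemma 3.2 `Step_L32` and the growth line `Step_avgGrowth` are not impugned).

Closed terms over Mathlib's `ℕ`/`ℝ`; axioms `propext`, `Classical.choice`, `Quot.sound`.  Refuter:
ns-claims-refuter-5; filed under interim convention (b) by the paired salvage prover.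

WHAT THIS IS NOT: not a claim about NS regularity or blow-up; not a claim about any author beyond the typed
locator.
-/

-- The summit's canonical theorem namespace repeats the summit name (single-conjunct summit).
set_option linter.dupNamespace false

noncomputable section
open Finset
open Literature.Claims.NS.Ri2025

namespace Summit.NavierStokesRegularity.NavierStokesRegularity.Theorems.Ri2025

/-! ### The window part and the level-count inequality (l.817–829) -/

/-- At `n = 2^{L−2}` the window level is `N = ⌈log₂ n⌉ + 2 = L`. [cite: Ri2025, §3 Step 2, l.806 (print p.12)] -/
theorem clog_n (q : ℕ) (hq : 1 ≤ q) : Nat.clog 2 (n q) + 2 = L q := by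
  have h3 := three_le_L hq
  unfold n
  rw [Nat.clog_pow _ _ (by norm_num)]
  omega

/-- The centre `L = 2^{2^q}` is a window level of `S(L)` ((4.1), window `k = q`).
[cite: Ri2025, (4.1) l.629–632 (print p.10)] -/
theorem L_mem_S {q : ℕ} (hq : 1 ≤ q) : L q ∈ S (L q) := by
  classical
  have h3 := three_le_L hq
  unfold S
  rw [Finset.mem_filter, Finset.mem_Icc]
  refine ⟨⟨by omega, le_rfl⟩, q, hq, ?_, ?_⟩
  · show 2 ^ (2 ^ q) - q ≤ L q
    exact Nat.sub_le _ _
  · show L q ≤ 2 ^ (2 ^ q) + 2 * q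
    exact Nat.le_add_right _ _

/-- Master lower bound for the window part: `windowSum (n q) ≥ 2^q/4 · n q`.
[cite: Ri2025, §3 Step 2, l.807–811 (print p.12)] -/
theorem windowSum_ge {q : ℕ} (hq : 1 ≤ q) : (2 : ℝ) ^ q / 4 * (n q) ≤ windowSum (n q) := by
  classical
  have h3 := three_le_L hq
  have hN := clog_n q hq
  have hLS := L_mem_S hq
  set T : Finset ℕ := Ioc (2 ^ (L q - 3)) (2 ^ (L q - 2)) with hT
  have hconst : ∀ k ∈ T, j₀ (2 * k) = L q := by
    intro k hk
    rw [hT, Finset.mem_Ioc] at hk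
    exact j₀_two_mul h3 hk.1 hk.2
  have hsub : T ⊆ (Icc 1 (n q)).filter (fun k => j₀ (2 * k) ∈ S (Nat.clog 2 (n q) + 2)) := by
    intro k hk
    have hk' := hk
    rw [hT, Finset.mem_Ioc] at hk'
    rw [Finset.mem_filter, Finset.mem_Icc, hconst k hk, hN]
    refine ⟨⟨?_, ?_⟩, hLS⟩
    · have : 1 ≤ 2 ^ (L q - 3) := Nat.one_le_two_pow
      omega
    · unfold n; exact hk'.2
  have hcard : T.card = 2 ^ (L q - 3) := by
    rw [hT, Nat.card_Ioc]
    have : 2 ^ (L q - 2) = 2 * 2 ^ (L q - 3) := by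
      rw [← Nat.pow_succ']; congr 1; omega
    omega
  unfold windowSum
  calc (2 : ℝ) ^ q / 4 * (n q) = (2 ^ (L q - 3) : ℕ) * ((2 : ℝ) ^ q / 2) := by
          unfold n
          have : L q - 2 = (L q - 3) + 1 := by omega
          rw [this]; push_cast; ring
    _ ≤ (T.card : ℝ) * b (L q) := by
          rw [hcard]
          exact mul_le_mul_of_nonneg_left (bL_ge hq) (by positivity)
    _ = ∑ k ∈ T, b (L q) := by rw [Finset.sum_const, nsmul_eq_mul]
    _ = ∑ k ∈ T, b (j₀ (2 * k)) := by
          apply Finset.sum_congr rfl; intro k hk; rw [hconst k hk]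
    _ ≤ _ := Finset.sum_le_sum_of_subset_of_nonneg hsub (fun k _ _ => b_nonneg _)

/-- The window bound "`Σ_{k≤n, j₀(2k)∈S(⌈log₂n⌉+2)} b(j₀(2k)) ≤ … ≤ n`, `∀ n ≥ n₀`" (l.817–829) is false.
[cite: Ri2025, §3 Step 2, l.817–829 (print p.13)] -/
theorem not_Step_avgWindow : ¬ Step_avgWindow := by
  rintro ⟨n₀, h⟩
  set q : ℕ := n₀ + 3 with hq_def
  have hq1 : 1 ≤ q := by omega
  have hqn : n₀ ≤ n q := by have := q_lt_n q hq1; omega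
  have hnpos : (0 : ℝ) < n q := by
    have := q_lt_n q hq1
    exact_mod_cast (show 0 < n q by omega)
  have h8 : (8 : ℝ) ≤ (2 : ℝ) ^ q := by
    have : (2 : ℝ) ^ 3 ≤ 2 ^ q := pow_le_pow_right₀ (by norm_num) (by omega)
    norm_num at this; exact this
  have hge := windowSum_ge hq1
  have hle := h (n q) hqn
  nlinarith

/-- The right side of the level-count inequality at `n = 2^{L−2}` is at most `L · 2^q`:
`|S(L)| ≤ L` and `log₂ L = 2^q`. [cite: Ri2025, §3 Step 2, l.817–821 (print p.13)] -/
theorem levelCount_rhs_le {q : ℕ} (hq : 1 ≤ q) :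
    ((S (Nat.clog 2 (n q) + 2)).card : ℝ) * Real.logb 2 ((Nat.clog 2 (n q) + 2 : ℕ) : ℝ) ≤
      (L q : ℝ) * 2 ^ q := by
  classical
  rw [clog_n q hq]
  have hcard : (S (L q)).card ≤ L q := by
    unfold S
    exact (Finset.card_filter_le _ _).trans (by simp)
  have hlog : Real.logb 2 ((L q : ℕ) : ℝ) = 2 ^ q := by
    unfold L; push_cast
    rw [Real.logb_pow, Real.logb_self_eq_one (by norm_num)]; push_cast; ring
  rw [hlog]
  exact mul_le_mul_of_nonneg_right (by exact_mod_cast hcard) (by positivity)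

/-- The key size comparison: for `q ≥ 2`, `L · 2^q < 2^q/4 · n` (i.e. `2^q + 4 < L = 2^{2^q}`).
[cite: Ri2025, §3 Step 2, l.817–821 (print p.13)] -/
theorem rhs_lt_lhs {q : ℕ} (hq : 2 ≤ q) : (L q : ℝ) * 2 ^ q < (2 : ℝ) ^ q / 4 * (n q) := by
  have h3 := three_le_L (by omega : 1 ≤ q)
  -- `2^q + 4 < L q`
  have hM : 4 ≤ 2 ^ q := by
    calc 4 = 2 ^ 2 := by norm_num
      _ ≤ 2 ^ q := Nat.pow_le_pow_right (by norm_num) hq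
  have hkey : 2 ^ q + 4 < L q := by
    unfold L
    set M := 2 ^ q with hM_def
    have h1 : M - 3 < 2 ^ (M - 3) := Nat.lt_two_pow_self
    have h2 : 2 ^ M = 2 ^ 3 * 2 ^ (M - 3) := by rw [← pow_add]; congr 1; omega
    omega
  -- compare exponents: L q * 2^q = 2^(2^q + q) and 2^q/4 * n q = 2^(q + L q - 4)
  have hL : (L q : ℝ) = 2 ^ (2 ^ q) := by unfold L; push_cast; ring
  have hn : (n q : ℝ) = 2 ^ (L q - 2) := by unfold n; push_cast; ring
  rw [hL, hn]
  have hexp : 2 ^ q + q + 2 < q + (L q - 2) := by omega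
  have := pow_lt_pow_right₀ (by norm_num : (1 : ℝ) < 2) hexp
  have e1 : (2 : ℝ) ^ (2 ^ q + q + 2) = 2 ^ (2 ^ q) * 2 ^ q * 4 := by
    rw [pow_add, pow_add]; norm_num
  have e2 : (2 : ℝ) ^ (q + (L q - 2)) = 2 ^ q * 2 ^ (L q - 2) := by rw [pow_add]
  rw [e1, e2] at this
  unfold L at this ⊢
  nlinarith [this]

/-- THE LEVEL-COUNT INEQUALITY as printed ("for every `n`", l.817–821) is false — already at `q = 2`
(`L = 16`, `n = 2^{14}`: `windowSum n ≥ 2^{14}` against `|S(16)| · log₂ 16 ≤ 64`).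
[cite: Ri2025, §3 Step 2, l.817–821 (print p.13)] -/
theorem not_Step_avgLevelCount : ¬ Step_avgLevelCount := by
  intro h
  have hq1 : (1 : ℕ) ≤ 2 := by norm_num
  have h1 := h (n 2) (by have := q_lt_n 2 hq1; omega)
  have := windowSum_ge hq1
  have := levelCount_rhs_le hq1
  have := rhs_lt_lhs (le_refl 2)
  linarith

/-- Its «eventually» reading (`∃ n₀ ∀ n ≥ n₀`, the charitable twin) is false as well.
[cite: Ri2025, §3 Step 2, l.817–821 (print p.13)] -/
theorem not_Step_avgLevelCountEv : ¬ Step_avgLevelCountEv := by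
  rintro ⟨n₀, h⟩
  set q : ℕ := n₀ + 2 with hq_def
  have hq1 : 1 ≤ q := by omega
  have hqn : n₀ ≤ n q := by have := q_lt_n q hq1; omega
  have h1 := h (n q) hqn
  have := windowSum_ge hq1
  have := levelCount_rhs_le hq1
  have := rhs_lt_lhs (by omega : 2 ≤ q)
  linarith

end Summit.NavierStokesRegularity.NavierStokesRegularity.Theorems.Ri2025

end
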